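import Summits.QuantumAdvantage.QuantumAdvantage.Theorems.RingPeriodFoldStrategies
import HarnessLib

/-!
# RingMinor (decomp-qadv lens-2 g11; tree package 1/3 of node «MinorDial»): the Y-MINOR of the ring game

The one-vertex contraction of the cycle `C_{N+1} → C_N` for the exact `RingHLF` relation (combinatorial shadow of a Pauli-`Y`
measurement of one vertex of the cycle graph state = local complementation + deletion): with `ins x'` = the pattern `x'` of
`C_{m+2}` with its two END letters flipped and a new `Y`-measured last letter, and `merge z x'` = the answer `z` of `C_{m+3}` with the
deleted vertex's bit XORed into its two neighbours (corrected by `x'` there),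
* `rel_ins_iff : Rel (ins x') z ↔ Rel x' (merge z x')` and `oddZeros_ins_iff : OddZeros (ins x') ↔ OddZeros x'` (§1),
* a kernel `decide` certificate on `C_3 / C_4` (§2).
No degree hypothesis here; the `𝔽₃`-degree transport and the length law are in `RingMinorLaw`, the deck law in `RingDeck`.
Supports items stmt-QuantumAdvantage-27380 / 27432 (`ExactnessDial.NoPerfectConst3` / `NoPerfectTwo3`).  The same dictionary was found
independently on the `𝔽₂`-degree axis by decomp-qadv lens-1 g7 («ResidueDial», `yStepLaw2`); one tree module should serve both.
-/

set_option linter.dupNamespace false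

namespace Summit.QuantumAdvantage.QuantumAdvantage.Theorems.RingMinor

open Finset
open Literature.Computability.QuantumComplexity Literature.Computability.QuantumComplexity.RingHLF
open Literature.Computability.MetaComplexity Literature.Computability.MetaComplexity.Smolensky
open Summit.QuantumAdvantage.AdviceFreeQNC0
open Summit.QuantumAdvantage.QuantumAdvantage.Theorems.RingPeriodFold

/-! ### §0 Ring-index bookkeeping on `Fin (k+1)` (no wrap-around except at the two named ends) -/

section ring_index
variable {k : ℕ}

/-- Ring-game helper `nxt_castSucc` (lens-2 law package; see the module docstring). -/
theorem nxt_castSucc (i : Fin k) : nxt (Fin.castSucc i) = i.succ := by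
  ext; simp only [nxt, Fin.val_castSucc, Fin.val_succ]
  exact Nat.mod_eq_of_lt (by omega)

/-- Ring-game helper `nxt_last_eq_zero` (lens-2 law package; see the module docstring). -/
theorem nxt_last_eq_zero : nxt (Fin.last k) = (0 : Fin (k + 1)) := by
  ext; simp [nxt]

/-- Ring-game helper `prv_succ` (lens-2 law package; see the module docstring). -/
theorem prv_succ (i : Fin k) : prv i.succ = Fin.castSucc i := by
  ext; simp only [prv, Fin.val_succ, Fin.val_castSucc]
  rw [show i.val + 1 + (k + 1) - 1 = i.val + (k + 1) by omega, Nat.add_mod_right]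
  exact Nat.mod_eq_of_lt (by omega)

/-- Ring-game helper `prv_zero_eq_last` (lens-2 law package; see the module docstring). -/
theorem prv_zero_eq_last : prv (0 : Fin (k + 1)) = Fin.last k := by
  ext; simp only [prv, Fin.val_zero, Fin.val_last]
  rw [Nat.zero_add, Nat.add_sub_cancel]
  exact Nat.mod_eq_of_lt (by omega)

/-- in `Fin (k+2)`: the predecessor of the last vertex is the image of the small ring's last vertex. -/
theorem prv_last_eq (k : ℕ) : prv (Fin.last (k + 1)) = Fin.castSucc (Fin.last k) := by
  rw [← Fin.succ_last, prv_succ]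

/-- for a non-last vertex `j` of `Fin (k+1)`, its successor taken in `Fin (k+2)` is the image of its successor. -/
theorem castSucc_nxt_of_ne_last {j : Fin (k + 1)} (hj : j ≠ Fin.last k) : Fin.castSucc (nxt j) = j.succ := by
  have hj' : j.val < k := Fin.val_lt_last hj
  ext; simp only [nxt, Fin.val_castSucc, Fin.val_succ]
  exact Nat.mod_eq_of_lt (by omega)

/-- for a non-zero vertex `j` of `Fin (k+1)`, its predecessor taken in `Fin (k+2)` is the image of its predecessor. -/
theorem prv_castSucc_of_ne_zero {j : Fin (k + 1)} (hj : j ≠ 0) : prv (Fin.castSucc j) = Fin.castSucc (prv j) := by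
  have hj' : 0 < j.val := Nat.pos_of_ne_zero fun h => hj (Fin.ext h)
  ext; simp only [prv, Fin.val_castSucc]
  rw [show j.val + (k + 1 + 1) - 1 = (j.val - 1) + (k + 1 + 1) by omega, Nat.add_mod_right,
    show j.val + (k + 1) - 1 = (j.val - 1) + (k + 1) by omega, Nat.add_mod_right,
    Nat.mod_eq_of_lt (by omega), Nat.mod_eq_of_lt (by omega)]

/-- extension of a vector by one last coordinate (a non-dependent `Fin.snoc`). -/
def ext' (f : Fin k → Bool) (c : Bool) : Fin (k + 1) → Bool := fun i => if h : i.val < k then f ⟨i.val, h⟩ else c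

/-- Ring-game helper `ext'_castSucc` (lens-2 law package; see the module docstring). -/
@[simp] theorem ext'_castSucc (f : Fin k → Bool) (c : Bool) (j : Fin k) : ext' f c (Fin.castSucc j) = f j := by
  simp [ext', j.isLt]

/-- Ring-game helper `ext'_last` (lens-2 law package; see the module docstring). -/
@[simp] theorem ext'_last (f : Fin k → Bool) (c : Bool) : ext' f c (Fin.last k) = c := by
  simp [ext']

/-- Ring-game helper `ext'_zero` (lens-2 law package; see the module docstring). -/
@[simp] theorem ext'_zero (f : Fin (k + 1) → Bool) (c : Bool) : ext' f c (0 : Fin (k + 1 + 1)) = f 0 := by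
  simp [ext']

/-- Ring-game helper `ext'_init` (lens-2 law package; see the module docstring). -/
theorem ext'_init (v : Fin (k + 1) → Bool) : ext' (fun j => v (Fin.castSucc j)) (v (Fin.last k)) = v := by
  funext i
  rcases Fin.eq_castSucc_or_eq_last i with ⟨j, rfl⟩ | rfl <;> simp

/-- a sum over `Fin (m+2)` with both END terms separated from the middle. -/
theorem sum_split_ends {m : ℕ} (h : Fin (m + 2) → ℕ) :
    ∑ j, h j = h 0 + (∑ i : Fin m, h (Fin.castSucc i).succ) + h (Fin.last (m + 1)) := by
  rw [Fin.sum_univ_succ, Fin.sum_univ_castSucc]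
  simp only [Fin.succ_last, Nat.succ_eq_add_one]
  ring

/-- Ring-game helper `mid_ne_zero` (lens-2 law package; see the module docstring). -/
theorem mid_ne_zero {m : ℕ} (i : Fin m) : (Fin.castSucc i).succ ≠ (0 : Fin (m + 2)) := Fin.succ_ne_zero _

/-- Ring-game helper `mid_ne_last` (lens-2 law package; see the module docstring). -/
theorem mid_ne_last {m : ℕ} (i : Fin m) : (Fin.castSucc i).succ ≠ Fin.last (m + 1) := by
  intro h
  have hi := i.isLt
  have := congrArg Fin.val h
  simp at this
  omega

/-- Ring-game helper `prv_castSucc_zero` (lens-2 law package; see the module docstring). -/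
theorem prv_castSucc_zero : prv (Fin.castSucc (0 : Fin (k + 1))) = Fin.last (k + 1) := by
  rw [Fin.castSucc_zero]; exact prv_zero_eq_last

end ring_index

/-! ### §1 The Y-minor (contraction of a `Y`-measured vertex): patterns, kernel vectors, answers -/

section minor
variable {m : ℕ}

/-- the last vertex of the SMALL ring `C_{m+2}`. -/
abbrev L (m : ℕ) : Fin (m + 2) := Fin.last (m + 1)

/-- flip the two letters adjacent to the contracted vertex (positions `0` and `L`). -/
def flipEnds (x' : Fin (m + 2) → Bool) : Fin (m + 2) → Bool :=
  fun j => if j = 0 ∨ j = L m then !x' j else x' j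

/-- Ring-game helper `flipEnds_zero` (lens-2 law package; see the module docstring). -/
@[simp] theorem flipEnds_zero (x' : Fin (m + 2) → Bool) : flipEnds x' 0 = !x' 0 := by simp [flipEnds]
/-- Ring-game helper `flipEnds_last` (lens-2 law package; see the module docstring). -/
@[simp] theorem flipEnds_last (x' : Fin (m + 2) → Bool) : flipEnds x' (L m) = !x' (L m) := by simp [flipEnds]
/-- Ring-game helper `flipEnds_mid` (lens-2 law package; see the module docstring). -/
theorem flipEnds_mid (x' : Fin (m + 2) → Bool) {j : Fin (m + 2)} (h0 : j ≠ 0) (hL : j ≠ L m) : flipEnds x' j = x' j := by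
  simp [flipEnds, h0, hL]

/-- **the Y-minor on patterns**: `ins x'` is the pattern of the BIG ring `C_{m+3}` whose last vertex carries the letter
`1` (a `Y`-measurement) and whose other letters are `x'` with the two neighbours of the last vertex flipped. -/
def ins (x' : Fin (m + 2) → Bool) : Fin (m + 2 + 1) → Bool := ext' (flipEnds x') true

/-- **the Y-minor on kernel vectors**: extend `v'` by `v'_L ⊕ v'_0` on the contracted vertex. -/
def ext (v' : Fin (m + 2) → Bool) : Fin (m + 2 + 1) → Bool := ext' v' (xor (v' (L m)) (v' 0))

/-- **the Y-minor on answers**: the contracted vertex's answer bit and the flipped letter are XOR-ed onto BOTH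
neighbours; all other answers are kept. -/
def merge (z : Fin (m + 2 + 1) → Bool) (x' : Fin (m + 2) → Bool) : Fin (m + 2) → Bool :=
  fun j => if j = 0 ∨ j = L m then xor (xor (z (Fin.castSucc j)) (z (Fin.last (m + 2)))) (x' j) else z (Fin.castSucc j)

/-- Ring-game helper `ins_castSucc` (lens-2 law package; see the module docstring). -/
@[simp] theorem ins_castSucc (x' : Fin (m + 2) → Bool) (j : Fin (m + 2)) : ins x' (Fin.castSucc j) = flipEnds x' j :=
  ext'_castSucc _ _ _
/-- Ring-game helper `ins_last` (lens-2 law package; see the module docstring). -/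
@[simp] theorem ins_last (x' : Fin (m + 2) → Bool) : ins x' (Fin.last (m + 2)) = true := ext'_last _ _
/-- Ring-game helper `ext_castSucc` (lens-2 law package; see the module docstring). -/
@[simp] theorem ext_castSucc (v' : Fin (m + 2) → Bool) (j : Fin (m + 2)) : ext v' (Fin.castSucc j) = v' j :=
  ext'_castSucc _ _ _
/-- Ring-game helper `ext_last` (lens-2 law package; see the module docstring). -/
@[simp] theorem ext_last (v' : Fin (m + 2) → Bool) : ext v' (Fin.last (m + 2)) = xor (v' (L m)) (v' 0) := ext'_last _ _
/-- Ring-game helper `ext_zero` (lens-2 law package; see the module docstring). -/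
@[simp] theorem ext_zero (v' : Fin (m + 2) → Bool) : ext v' (0 : Fin (m + 2 + 1)) = v' 0 := ext'_zero _ _
/-- Ring-game helper `ins_zero` (lens-2 law package; see the module docstring). -/
@[simp] theorem ins_zero (x' : Fin (m + 2) → Bool) : ins x' (0 : Fin (m + 2 + 1)) = !x' 0 := by
  rw [ins, ext'_zero, flipEnds_zero]
/-- Ring-game helper `succ_L` (lens-2 law package; see the module docstring). -/
theorem succ_L : (Fin.last (m + 1)).succ = Fin.last (m + 2) := Fin.succ_last _
/-- Ring-game helper `merge_zero` (lens-2 law package; see the module docstring). -/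
@[simp] theorem merge_zero (z : Fin (m + 2 + 1) → Bool) (x' : Fin (m + 2) → Bool) :
    merge z x' 0 = xor (xor (z 0) (z (Fin.last (m + 2)))) (x' 0) := by simp [merge]
/-- Ring-game helper `merge_last` (lens-2 law package; see the module docstring). -/
@[simp] theorem merge_last (z : Fin (m + 2 + 1) → Bool) (x' : Fin (m + 2) → Bool) :
    merge z x' (L m) = xor (xor (z (Fin.castSucc (L m))) (z (Fin.last (m + 2)))) (x' (L m)) := by simp [merge]
/-- Ring-game helper `merge_mid` (lens-2 law package; see the module docstring). -/
theorem merge_mid (z : Fin (m + 2 + 1) → Bool) (x' : Fin (m + 2) → Bool) {j : Fin (m + 2)} (h0 : j ≠ 0) (hL : j ≠ L m) :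
    merge z x' j = z (Fin.castSucc j) := by simp [merge, h0, hL]

/-- Ring-game helper `zero_ne_L` (lens-2 law package; see the module docstring). -/
theorem zero_ne_L : (0 : Fin (m + 2)) ≠ L m := by
  intro h; have := congrArg Fin.val h; simp at this

/-- **KERNEL TRANSPORT**: the kernel vectors of the big ring at `ins x'` are exactly the extensions `ext v'` of the kernel
vectors of the small ring at `x'` (the contracted vertex's coordinate is forced to `v'_L ⊕ v'_0`). -/
theorem inKernel_ins_iff (x' v' : Fin (m + 2) → Bool) (c : Bool) :
    InKernel (ins x') (ext' v' c) ↔ InKernel x' v' ∧ c = xor (v' (L m)) (v' 0) := by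
  unfold InKernel
  rw [Fin.forall_fin_succ']
  have hlast : (xor (xor (ext' v' c (prv (Fin.last (m + 2)))) (ext' v' c (nxt (Fin.last (m + 2)))))
      (ins x' (Fin.last (m + 2)) && ext' v' c (Fin.last (m + 2)))) = false ↔ c = xor (v' (L m)) (v' 0) := by
    rw [prv_last_eq, nxt_last_eq_zero, ext'_castSucc, ext'_zero, ext'_last, ins_last]
    cases c <;> cases v' (L m) <;> cases v' 0 <;> decide
  have hcs : ∀ j : Fin (m + 2), c = xor (v' (L m)) (v' 0) →
      ((xor (xor (ext' v' c (prv (Fin.castSucc j))) (ext' v' c (nxt (Fin.castSucc j))))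
        (ins x' (Fin.castSucc j) && ext' v' c (Fin.castSucc j))) = false ↔
       (xor (xor (v' (prv j)) (v' (nxt j))) (x' j && v' j)) = false) := by
    intro j hc
    rw [nxt_castSucc, ext'_castSucc, ins_castSucc]
    by_cases h0 : j = 0
    · subst h0
      rw [prv_castSucc_zero, ext'_last, ← castSucc_nxt_of_ne_last zero_ne_L, ext'_castSucc, prv_zero_eq_last,
        flipEnds_zero, hc]
      cases v' (Fin.last (m + 1)) <;> cases v' 0 <;> cases v' (nxt 0) <;> cases x' 0 <;> decide
    · by_cases hL : j = L m
      · subst hL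
        rw [succ_L, ext'_last, prv_castSucc_of_ne_zero h0, ext'_castSucc, flipEnds_last, hc, nxt_last_eq_zero]
        cases v' (Fin.last (m + 1)) <;> cases v' 0 <;> cases v' (prv (Fin.last (m + 1))) <;> cases x' (Fin.last (m + 1)) <;>
          decide
      · rw [prv_castSucc_of_ne_zero h0, ext'_castSucc, ← castSucc_nxt_of_ne_last hL, ext'_castSucc, flipEnds_mid x' h0 hL]
  constructor
  · rintro ⟨hall, hl⟩
    have hc := hlast.1 hl
    exact ⟨fun j => (hcs j hc).1 (hall j), hc⟩
  · rintro ⟨hall, hc⟩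
    exact ⟨fun j => (hcs j hc).2 (hall j), hlast.2 hc⟩

/-- every kernel vector of the big ring at `ins x'` is `ext` of its restriction, which is a kernel vector of the small ring. -/
theorem inKernel_ins_cases {x' : Fin (m + 2) → Bool} {v : Fin (m + 2 + 1) → Bool} (hv : InKernel (ins x') v) :
    InKernel x' (fun j => v (Fin.castSucc j)) ∧ v = ext (fun j => v (Fin.castSucc j)) := by
  set v' : Fin (m + 2) → Bool := fun j => v (Fin.castSucc j) with hv'
  have hvv : v = ext' v' (v (Fin.last (m + 2))) := (ext'_init v).symm
  rw [hvv] at hv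
  obtain ⟨h1, h2⟩ := (inKernel_ins_iff x' v' _).1 hv
  refine ⟨h1, ?_⟩
  rw [ext, ← h2]
  exact hvv

/-- Ring-game helper `inKernel_ext` (lens-2 law package; see the module docstring). -/
theorem inKernel_ext {x' v' : Fin (m + 2) → Bool} (hv' : InKernel x' v') : InKernel (ins x') (ext v') :=
  (inKernel_ins_iff x' v' _).2 ⟨hv', rfl⟩

/-! #### the three counting identities (edges, weights, inner products), as sums with the end terms separated -/

/-- middle part of the edge count (common to both rings). -/
def midE (v' : Fin (m + 2) → Bool) : ℕ := ∑ i : Fin (m + 1), if v' (Fin.castSucc i) = true ∧ v' i.succ = true then 1 else 0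
/-- middle part of the weight count (common to both rings). -/
def midW (x' v' : Fin (m + 2) → Bool) : ℕ :=
  ∑ i : Fin m, if x' (Fin.castSucc i).succ = true ∧ v' (Fin.castSucc i).succ = true then 1 else 0
/-- middle part of the inner product (common to both rings). -/
def midD (v' : Fin (m + 2) → Bool) (z : Fin (m + 2 + 1) → Bool) : ℕ :=
  ∑ i : Fin m, if v' (Fin.castSucc i).succ = true ∧ z (Fin.castSucc (Fin.castSucc i).succ) = true then 1 else 0

/-- Ring-game helper `edgesIn_small` (lens-2 law package; see the module docstring). -/
theorem edgesIn_small (v' : Fin (m + 2) → Bool) :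
    edgesIn v' = midE v' + (if v' (L m) = true ∧ v' 0 = true then 1 else 0) := by
  unfold edgesIn midE
  rw [Finset.card_filter, Fin.sum_univ_castSucc]
  congr 1
  · refine Finset.sum_congr rfl fun i _ => ?_
    rw [nxt_castSucc]
  · rw [show nxt (Fin.last (m + 1)) = 0 from nxt_last_eq_zero]

/-- Ring-game helper `edgesIn_ext` (lens-2 law package; see the module docstring). -/
theorem edgesIn_ext (v' : Fin (m + 2) → Bool) :
    edgesIn (ext v') = midE v' + (if v' (L m) = true ∧ xor (v' (L m)) (v' 0) = true then 1 else 0)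
      + (if xor (v' (L m)) (v' 0) = true ∧ v' 0 = true then 1 else 0) := by
  unfold edgesIn midE
  rw [Finset.card_filter, Fin.sum_univ_castSucc, Fin.sum_univ_castSucc]
  congr 1; congr 1
  · refine Finset.sum_congr rfl fun i _ => ?_
    rw [nxt_castSucc, ext_castSucc, Fin.succ_castSucc, ext_castSucc]
  · rw [nxt_castSucc, ext_castSucc, succ_L, ext_last]
  · rw [nxt_last_eq_zero, ext_last, ext_zero]

/-- Ring-game helper `wtAnd_small` (lens-2 law package; see the module docstring). -/
theorem wtAnd_small (x' v' : Fin (m + 2) → Bool) :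
    wtAnd x' v' = (if x' 0 = true ∧ v' 0 = true then 1 else 0) + midW x' v' + (if x' (L m) = true ∧ v' (L m) = true then 1 else 0) := by
  unfold wtAnd midW
  rw [Finset.card_filter, sum_split_ends]

/-- Ring-game helper `wtAnd_ins_ext` (lens-2 law package; see the module docstring). -/
theorem wtAnd_ins_ext (x' v' : Fin (m + 2) → Bool) :
    wtAnd (ins x') (ext v') = (if (!x' 0) = true ∧ v' 0 = true then 1 else 0) + midW x' v'
      + (if (!x' (L m)) = true ∧ v' (L m) = true then 1 else 0) + (if xor (v' (L m)) (v' 0) = true then 1 else 0) := by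
  unfold wtAnd midW
  rw [Finset.card_filter, Fin.sum_univ_castSucc, sum_split_ends]
  have hmid : (∑ i : Fin m, if ins x' (Fin.castSucc (Fin.castSucc i).succ) = true ∧ ext v' (Fin.castSucc (Fin.castSucc i).succ) = true
      then 1 else 0) = ∑ i : Fin m, if x' (Fin.castSucc i).succ = true ∧ v' (Fin.castSucc i).succ = true then 1 else 0 :=
    Finset.sum_congr rfl fun i _ => by rw [ins_castSucc, ext_castSucc, flipEnds_mid x' (mid_ne_zero i) (mid_ne_last i)]
  rw [hmid]
  simp only [ins_castSucc, ext_castSucc, flipEnds_zero, flipEnds_last, ins_last, ext_last, true_and]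

/-- Ring-game helper `dotN_merge` (lens-2 law package; see the module docstring). -/
theorem dotN_merge (v' : Fin (m + 2) → Bool) (z : Fin (m + 2 + 1) → Bool) (x' : Fin (m + 2) → Bool) :
    (univ.filter fun b : Fin (m + 2) => v' b = true ∧ merge z x' b = true).card
      = (if v' 0 = true ∧ merge z x' 0 = true then 1 else 0) + midD v' z + (if v' (L m) = true ∧ merge z x' (L m) = true then 1 else 0) := by
  unfold midD
  rw [Finset.card_filter, sum_split_ends]
  congr 2
  refine Finset.sum_congr rfl fun i _ => ?_
  rw [merge_mid z x' (mid_ne_zero i) (mid_ne_last i)]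

/-- Ring-game helper `dotN_ext` (lens-2 law package; see the module docstring). -/
theorem dotN_ext (v' : Fin (m + 2) → Bool) (z : Fin (m + 2 + 1) → Bool) :
    (univ.filter fun b : Fin (m + 2 + 1) => ext v' b = true ∧ z b = true).card
      = (if v' 0 = true ∧ z 0 = true then 1 else 0) + midD v' z
        + (if v' (L m) = true ∧ z (Fin.castSucc (L m)) = true then 1 else 0)
        + (if xor (v' (L m)) (v' 0) = true ∧ z (Fin.last (m + 2)) = true then 1 else 0) := by
  unfold midD
  rw [Finset.card_filter, Fin.sum_univ_castSucc, sum_split_ends]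
  simp only [ext_castSucc, ext_last, ext_zero, Fin.castSucc_zero]

/-- **INNER-PRODUCT IDENTITY** (mod 2): `⟨v', merge z x'⟩ ≡ ⟨ext v', z⟩ + x'_0 v'_0 + x'_L v'_L`. -/
theorem dot2_merge (v' : Fin (m + 2) → Bool) (z : Fin (m + 2 + 1) → Bool) (x' : Fin (m + 2) → Bool) :
    dot2 v' (merge z x') = (dot2 (ext v') z + (if x' 0 = true ∧ v' 0 = true then 1 else 0)
      + (if x' (L m) = true ∧ v' (L m) = true then 1 else 0)) % 2 := by
  unfold dot2
  rw [dotN_merge, dotN_ext, merge_zero, merge_last]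
  generalize midD v' z = S
  cases v' 0 <;> cases v' (L m) <;> cases x' 0 <;> cases x' (L m) <;> cases z 0 <;> cases z (Fin.castSucc (L m)) <;>
    cases z (Fin.last (m + 2)) <;> simp <;> omega

/-- **SIGN IDENTITY** (mod 2, on vectors of even weight — every kernel vector is one):
`ℓ_{x'}(v') ≡ ℓ_{ins x'}(ext v') + x'_0 v'_0 + x'_L v'_L`. -/
theorem signBit_ext (x' v' : Fin (m + 2) → Bool) (hev : Even (wtAnd x' v')) :
    signBit x' v' = (signBit (ins x') (ext v') + (if x' 0 = true ∧ v' 0 = true then 1 else 0)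
      + (if x' (L m) = true ∧ v' (L m) = true then 1 else 0)) % 2 := by
  unfold signBit
  rw [wtAnd_small] at hev
  rw [edgesIn_small, edgesIn_ext, wtAnd_small, wtAnd_ins_ext]
  generalize midE v' = S at *
  generalize midW x' v' = T at *
  obtain ⟨r, hr⟩ := hev
  cases v' 0 <;> cases v' (L m) <;> cases x' 0 <;> cases x' (L m) <;> simp at hr ⊢ <;> omega

/-- **THE Y-MINOR LAW (answers)**: an answer string `z` is valid for the big ring at `ins x'` iff the merged string is
valid for the small ring at `x'` — for EVERY pattern `x'` of the small ring `C_{m+2}`. -/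
theorem rel_ins_iff (x' : Fin (m + 2) → Bool) (z : Fin (m + 2 + 1) → Bool) :
    RingHLF.Rel (ins x') z ↔ RingHLF.Rel x' (merge z x') := by
  unfold RingHLF.Rel
  constructor
  · intro h v' hv'
    have hb := h (ext v') (inKernel_ext hv')
    have hev := wtAnd_even_of_inKernel x' v' hv'
    rw [dot2_merge, signBit_ext x' v' hev, hb]
  · intro h v hv
    obtain ⟨hv', hve⟩ := inKernel_ins_cases hv
    rw [hve]
    generalize (fun j => v (Fin.castSucc j)) = v' at hv' ⊢
    have hs := h v' hv'
    have hev := wtAnd_even_of_inKernel x' v' hv'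
    rw [dot2_merge, signBit_ext x' v' hev] at hs
    have h1 : dot2 (ext v') z < 2 := Nat.mod_lt _ (by norm_num)
    have h2 : signBit (ins x') (ext v') < 2 := Nat.mod_lt _ (by norm_num)
    revert hs h1 h2
    generalize dot2 (ext v') z = a
    generalize signBit (ins x') (ext v') = b
    cases x' 0 <;> cases v' 0 <;> cases x' (L m) <;> cases v' (L m) <;> simp <;> omega

/-- **THE Y-MINOR LAW (patterns)**: the odd class is transported. -/
theorem oddZeros_ins_iff (x' : Fin (m + 2) → Bool) : OddZeros (ins x') ↔ OddZeros x' := by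
  unfold OddZeros
  rw [Finset.card_filter, Finset.card_filter, Fin.sum_univ_castSucc, sum_split_ends, sum_split_ends]
  simp only [ins_castSucc, ins_last, flipEnds_zero, flipEnds_last]
  rw [show (∑ i : Fin m, if flipEnds x' (Fin.castSucc i).succ = false then 1 else 0)
      = ∑ i : Fin m, if x' (Fin.castSucc i).succ = false then 1 else 0 from
      Finset.sum_congr rfl fun i _ => by rw [flipEnds_mid x' (mid_ne_zero i) (mid_ne_last i)]]
  generalize (∑ i : Fin m, if x' (Fin.castSucc i).succ = false then 1 else 0) = S
  cases x' 0 <;> cases x' (L m) <;> simp <;> omega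

end minor

/-! ### §2 A kernel-checked INSTANCE of the Y-minor law (independent of the proof above: `decide` on the tree's `Rel`) -/

/-- CERTIFICATE (`decide`, smallest size: small ring `C_3`, big ring `C_4`): for all `2³ · 2⁴` pairs (pattern, answer),
`Rel₄ (ins x') z ↔ Rel₃ x' (merge z x')` — the contraction dictionary checked against the tree's definition of the ring relation. -/
theorem rel_ins_iff_three_four : ∀ x' : Fin 3 → Bool, ∀ z : Fin 4 → Bool,
    RingHLF.Rel (ins (m := 1) x') z ↔ RingHLF.Rel x' (merge (m := 1) z x') := by
  decide


end Summit.QuantumAdvantage.QuantumAdvantage.Theorems.RingMinor
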